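import Literature.MathematicalPhysics.QuantumFieldTheory.Balaban1983to89.TreeLengthTorusTransfer

/-!
# Dimock, *The renormalization group according to Balaban* I, §3 Lemma 10 (reblocking): decay in the tree length
is REGENERATED by the block map — PROVED on the cell's periodic polymer model, every dimension

**Citation header (reproduction of PUBLISHED work; template of the Balaban lattice Yang–Mills cell).**
J. Dimock, *The renormalization group according to Balaban. I. Small fields*, Rev. Math. Phys. **25** (2013) 1330010
(= arXiv:1108.1335v2) [Dimock2013], §3 "scaling and reblocking": the `LM`-polymers `𝒟⁰_{k+1}` (TeX L1381–1384), the
block map `X ↦ X̄` and the reblocking operator `ℬ` (L1429–1440) and Lemma 10 `\label{citizen}` (L1443–1478) with its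
proof (study0)–(slum)–(study00).  TeX line numbers refer to the arXiv source held by the cell
(`inputs/files/dimock/src/1108.1335/1108.1335.tex`, 4263 lines, sha256[:16] 7382e6540dded9be).

**What the paper prints (verbatim).**  L1381–1384: *"An LM-polymer Y in 𝕋^{−k}_{𝖬+𝖭−k} is a connected union of
LM = L^{m+1} cubes centered on the points of 𝕋^{m+1}_{𝖬+𝖭−k}. The set of all LM polymers is denoted 𝒟⁰_{k+1}."*;
L1429–1435: *"To prepare for scaling we need a reblocking operation. If X ∈ 𝒟_k let X̄ ∈ 𝒟⁰_{k+1} be the union of all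
LM cubes intersecting X. Given E ∈ 𝒦_k we define functionals ℬE ∈ 𝒦⁰_{k+1} by (ℬE)(Y, φ) = Σ_{X ∈ 𝒟_k : X̄ = Y}
E(X, φ)"*; L1436–1440: *"Then we have Σ_{X ∈ 𝒟_k} E(X, φ) = Σ_{Y ∈ 𝒟⁰_{k+1}} (ℬE)(Y, φ)"*; **Lemma 10 (reblocking)**
(L1443–1448): *"For κ′ = L(κ − κ₀ − 1):  ‖ℬE‖_{k,κ′} ≤ 9 K₀ L³ ‖E‖_{k,κ}  where the norm on the left is defined with
d_{LM}"*, the norm being (L1333) *"‖E‖_{k,κ} = sup_X ‖E(X)‖_k e^{κ d_M(X)}"*.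
PROOF as printed: *"If X̄ = Y then a minimal tree on the M blocks in X is also a tree on the LM blocks in Y and so
M d_M(X) ≥ LM d_{LM}(Y) or d_M(X) ≥ L d_{M}(Y)* [sic; = `L d_{LM}(Y)`, as in the preceding clause — TeX L1454] *.
Therefore ‖ℬE(Y)‖_k ≤ Σ_{X̄ = Y} ‖E(X)‖_k ≤ ‖E‖_{k,κ} Σ_{X̄ = Y} e^{−κ d_M(X)} ≤ ‖E‖_{k,κ} e^{−(κ−κ₀)L d_{M}(Y)}* [sic;
`d_{LM}(Y)`, TeX L1460] *Σ_{X̄ = Y} e^{−κ₀ d_M(X)}"* (study0); *"If X̄ = Y there must be an M-cube □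
so □ ⊂ X ⊂ Y. Using this and (summing0) yields Σ_{X: X̄ = Y} e^{−κ₀ d_M(X)} ≤ Σ_{□ ⊂ Y} Σ_{X ⊃ □} e^{−κ₀ d_M(X)} ≤ |Y|_M
Σ_{X ⊃ □} e^{−κ₀ d_M(X)} ≤ K₀ L³ |Y|_{LM}"* (slum); *"But by (ninety) |Y|_{LM} ≤ 9(1 + d_{LM}(Y)) ≤ 9e^{d_{LM}(Y)} so we
have ‖ℬE(Y)‖_k ≤ 9K₀L³‖E‖_{k,κ} e^{−(L(κ−κ₀)−1) d_{LM}(Y)} ≤ 9K₀L³‖E‖_{k,κ} e^{−κ′ d_{LM}(Y)}"* (study00).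

**What is reproduced here (kernel-checked, zero `sorry`).**  Every input of that proof is ALREADY a theorem of the
cell's tree-length modules on the PERIODIC carrier, in every dimension `d` (unit pv22: `…Balaban1983to89.TreeLengthTorus`,
`…TreeLengthTorusTransfer`; unit pv11: `…B13ScaleTransfer`; unit pv03: `…B12TreeDecay`): the fine torus has `L·N′`
`M`-cubes per direction (`TPt d (L·N′)`), the coarse one `N′` `LM`-blocks per direction (`TPt d N′`), the block map is
`tcoarse L N′` and
* proof l.1 (exact coarsening) = `TreeLengthTorusTransfer.mul_torusTreeLen_image_le` (`L·d(X̄) ≤ d(X)`);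
* (summing0) = `TreeLengthTorus.sum_exp_torusTreeLen_le` (`κ ≥ κ₀(4·2^d, 2d)`, constant `K₀(4·2^d, 2d)` of `…B12TreeDecay`);
* (ninety)-type volume bound = `TreeLengthTorus.card_le_torusTreeLen` (`|Y| ≤ 2^d(4 d(Y) + 1)`);
* `X̄ ∈ 𝒟⁰_{k+1}` = `TreeLengthTorusTransfer.tFaceConnected_image_tcoarse`.
This module supplies the remaining bookkeeping and PROVES: Part 1 — `𝒟_k` (`doms`), `X̄` (`bar`), `ℬ` (`reblock`), the
identity Σ_X E(X) = Σ_Y (ℬE)(Y) (`sum_reblock`); Part 2 — the fibre count *"|Y|_M = L^d |Y|_{LM}"* in the form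
`#{□ : □̄ ∈ Y} ≤ L^d·|Y|` (`card_filter_tcoarse_mem_le`, from pv11's `coarse_eq_iff`) and the (slum) re-indexing
(`sum_filter_bar_le`); Part 3 — **LEMMA 10**, as a norm-bound-in ⇒ norm-bound-out statement for `E` valued in any
seminormed group (`norm_reblock_le`: `‖E(X)‖ ≤ A e^{−κ d(X)}` on `𝒟_k` ⟹ `‖ℬE(Y)‖ ≤ 2^d K₀ L^d A e^{−(L(κ−κ₀) − 4) d(Y)}`
on `𝒟⁰_{k+1}`), in the PRINTED SHAPE `κ′ = L(κ − κ₀ − 1)` for every `L ≥ 4` (`norm_reblock_le_printed`), and as the printed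
sup-norm inequality `‖ℬE‖_{κ′} ≤ 2^d K₀ L^d ‖E‖_κ` (`decayNorm`, `decayNorm_reblock_le`); `d = 3`: constant `8 K₀ L³`
(`decayNorm_reblock_le_three`); Part 4 (v1.1) — the same-rate form (shotgun) *"Assuming κ ≤ κ′ (a condition that κ be
large) we have ‖(ℬE)_{L^{−1}}‖_{k+1,κ} ≤ 9K₀L³‖E‖_{k,κ}"* (TeX L1492–1495): `decayNorm_reblock_le_same_rate`.

**Divergence from the printed constants (declared; cell DIVERGENCE D-pv22.1 conventions for the tree length).**  Dimock's
`9` stands in for the constant of his (ninety) (L1345–1347) *"d_M(X) ≤ |X|_M ≤ 3^d(1 + d_M(X))"*, *"here with d=3"*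
(TEMPLATE.md §1 C3(iv): `3³ = 27`, harmless — any constant is absorbed into one unit of decay); the
cell's volume constant is `2^d(4·d + 1)` (the repaired additive form of [Balaban1988RG2Cluster] (2.30) = [Dimock2013BalabanII]
App. E Lemma E.1(3) in substance), whence the prefactor `2^d K₀ L^d` and a rate offset `4` in place of `1`:
`κ′_tree = L(κ − κ₀) − 4 ≥ L(κ − κ₀ − 1) = κ′_printed` as soon as `L ≥ 4` — so the printed shape holds verbatim for
`L ≥ 4` (Dimock: *"L sufficiently large"* throughout).  `κ₀, K₀` *"depending only on the dimension"* are instantiated by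
`kappa₀ (4·2^d) (2d)`, `K₀ (4·2^d) (2d)`.  The scaling remark after the lemma (TeX L1481–1490, `d_{LM}(LX) = d_M(X)`,
the map `E ↦ (ℬE)_{L^{−1}}` from `𝒦_k` to `𝒦_{k+1}`) is built into the model: the coarse torus `TPt d N′` IS the index
set of the `LM`-blocks = the `M`-cubes of the next scale ([Balaban1987RG1] p. 257 *"Domains from different classes …
are connected by scaling transformations"*, as recorded in `…TreeLengthTorusTransfer`).

**What is NOT claimed.**  Nothing about the field dependence `φ` (the norms *"‖E(X)‖_k = sup_{φ ∈ ℛ_k} ‖E(X, φ)‖"* of §3.1, TeX L1322–1324, enter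
only through the triangle inequality, so `E` is typed with values in an arbitrary seminormed additive group); nothing about
[Dimock2013] beyond Lemma 10; nothing about any Bałaban paper — the B-side analogue (the rate bookkeeping of
[Balaban1988RG2Cluster] pp. 19–21 after (2.36), cell GAPS.md C-B13-06, `…B13ScaleTransfer` Part 4) is a different
computation with the factor `½L`.  Dimock's papers are published and refereed and are the cell's TEMPLATE, not
manuscripts under audit.  Value = kernel closure of TEMPLATE.md §15.1 row G7 over the cell's own polymer model, NOT
summit progress (YM₄ on T⁴ / infinite volume / mass gap are elsewhere and out of scope).

Cell records: TEMPLATE.md §15.1 G7 / §15.2; unit `b2b-balaban-template` gen 14, journal claim D1-REBLOCKING-KERNEL.  NEW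
leaf; imports `…Balaban1983to89.TreeLengthTorusTransfer` (unit pv22, p179186) only; modifies nothing.  v1 = p183046
(cross-read: cell GAPS.md C-adv8-43, ok — objections 0; its one DOCFIX, the two [sic] marks on the source typo
«d_{M}(Y)» of TeX L1454/L1460 and the locator L1384, folded here); v1.1: + Part 4 = (shotgun0)/(shotgun), the SAME-RATE
form of Lemma 10 used downstream (TeX L1481–1495: `decayNorm_mono`, `decayNorm_reblock_le_same_rate`,
`decayNorm_reblock_le_same_rate_three`), append-only after the v1 declarations (v1 declaration region byte-identical;
docstring edits as listed).
-/

noncomputable section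

open Real Finset
open Literature.MathematicalPhysics.QuantumFieldTheory.Balaban1983to89.B13ScaleTransfer (Pt coarse coarse_eq_iff)
open Literature.MathematicalPhysics.QuantumFieldTheory.Balaban1983to89.TreeLengthTorus
  (TPt proj natLift proj_natLift TFaceConnected torusTreeLen torusTreeLen_nonneg sum_exp_torusTreeLen_le
    card_le_torusTreeLen)
open Literature.MathematicalPhysics.QuantumFieldTheory.Balaban1983to89.TreeLengthTorusTransfer
  (tcoarse mul_torusTreeLen_image_le tFaceConnected_image_tcoarse)
open Literature.MathematicalPhysics.QuantumFieldTheory.Balaban1983to89.B12TreeDecay (kappa₀ K₀ K₀_pos)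

namespace Literature.MathematicalPhysics.QuantumFieldTheory.Dimock2011to13.Reblocking

variable {d : ℕ}

/-! ## Part 1. `𝒟_k` on the torus, the block map `X ↦ X̄`, the reblocking operator `ℬ` -/

/-- `𝒟_k` ON THE TORUS with `n` `M`-cubes per direction, every dimension `d`: the non-empty families of cubes connected
through common `(d−1)`-faces — [Dimock2013] §3.1, verbatim: *"An M-polymer X is a connected unions of such cubes. Here
connected means that for any two cubes □, □′ in X there is a sequence □ = □₀, □₁, □₂, …, □_m = □′ such that □_j ⊂ X
and □_j and □_{j+1} have a (d−1) = 2 dimensional face in common."*, *"𝒟_k = all M-polymers X in 𝕋^{−k}_{𝖬+𝖭−k}"*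
(= the cell's torus localization domains `TreeLengthTorus.IsTDom`). [cite: Dimock2013, §3.1 (arXiv:1108.1335v2 TeX L1163–1170)] -/
def doms (d n : ℕ) [NeZero n] : Finset (Finset (TPt d n)) := by
  classical exact univ.filter fun X => X.Nonempty ∧ TFaceConnected X

/-- Membership in `𝒟_k`. [cite: Dimock2013, §3.1 (arXiv:1108.1335v2 TeX L1163–1170)] -/
theorem mem_doms {n : ℕ} [NeZero n] {X : Finset (TPt d n)} : X ∈ doms d n ↔ X.Nonempty ∧ TFaceConnected X := by
  classical
  unfold doms
  simp

/-- A single cube is a polymer. [folklore] -/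
theorem singleton_mem_doms {n : ℕ} [NeZero n] (a : TPt d n) : ({a} : Finset (TPt d n)) ∈ doms d n := by
  refine mem_doms.2 ⟨singleton_nonempty a, ?_⟩
  intro x hx y hy
  rw [mem_singleton] at hx hy
  subst hx; subst hy
  exact Relation.ReflTransGen.refl

/-- `𝒟_k` is non-empty (the torus has a cube). [folklore] -/
theorem doms_nonempty (d n : ℕ) [NeZero n] : (doms d n).Nonempty :=
  ⟨{0}, singleton_mem_doms 0⟩

/-- The polymers THROUGH a given cube `□` — the index set of (summing0) *"for any M-cube □: Σ_{X ⊃ □} …"*.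
[cite: Dimock2013, §3.1 eq. (summing0) (arXiv:1108.1335v2 TeX L1350–1355)] -/
def domsAt (d n : ℕ) [NeZero n] (c : TPt d n) : Finset (Finset (TPt d n)) := by
  classical exact univ.filter fun X => c ∈ X ∧ TFaceConnected X

/-- Membership in `domsAt`. [cite: Dimock2013, §3.1 eq. (summing0) (arXiv:1108.1335v2 TeX L1350–1355)] -/
theorem mem_domsAt {n : ℕ} [NeZero n] {c : TPt d n} {X : Finset (TPt d n)} :
    X ∈ domsAt d n c ↔ c ∈ X ∧ TFaceConnected X := by
  classical
  unfold domsAt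
  simp

section TwoScales

variable (L N' : ℕ) [NeZero L] [NeZero N']

/-- `X̄` — [Dimock2013] §3, verbatim: *"If X ∈ 𝒟_k let X̄ ∈ 𝒟⁰_{k+1} be the union of all LM cubes intersecting X"*,
read on the next scale's index set: the family of `LM`-cubes (cubes of the coarse torus, `N′` per direction) met by the
family `X` of `M`-cubes of the fine torus (`L·N′` per direction); the block map is unit pv22's `tcoarse L N′`
(ā ↦ ⌊a/L⌋ mod N′). [cite: Dimock2013, §3 (arXiv:1108.1335v2 TeX L1429–1431)] -/
def bar (X : Finset (TPt d (L * N'))) : Finset (TPt d N') := X.image (tcoarse L N')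

/-- THE REBLOCKING OPERATOR — [Dimock2013] §3, verbatim: *"Given E ∈ 𝒦_k we define functionals ℬE ∈ 𝒦⁰_{k+1} by
(ℬE)(Y, φ) = Σ_{X ∈ 𝒟_k : X̄ = Y} E(X, φ)"* (`E` valued in any additive commutative monoid — in the paper, functions of
the field `φ`). [cite: Dimock2013, §3 (arXiv:1108.1335v2 TeX L1431–1435)] -/
def reblock {V : Type*} [AddCommMonoid V] (E : Finset (TPt d (L * N')) → V) (Y : Finset (TPt d N')) : V :=
  ∑ X ∈ (doms d (L * N')).filter (fun X => bar L N' X = Y), E X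

variable {L N'}

/-- *"let X̄ ∈ 𝒟⁰_{k+1} be …"*: `X ∈ 𝒟_k ⟹ X̄ ∈ 𝒟⁰_{k+1}` — the blocks met by a polymer form a polymer of the coarse
torus (pv22's `tFaceConnected_image_tcoarse`). [cite: Dimock2013, §3 (arXiv:1108.1335v2 TeX L1381–1384, L1429–1431)] -/
theorem bar_mem_doms {X : Finset (TPt d (L * N'))} (hX : X ∈ doms d (L * N')) : bar L N' X ∈ doms d N' := by
  rw [mem_doms] at hX ⊢
  exact ⟨hX.1.image _, tFaceConnected_image_tcoarse hX.2⟩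

/-- **Σ_{X ∈ 𝒟_k} E(X) = Σ_{Y ∈ 𝒟⁰_{k+1}} (ℬE)(Y)** — [Dimock2013] §3, *"Then we have …"* (TeX L1436–1440), PROVED
(fibrewise summation along `X ↦ X̄`). [cite: Dimock2013, §3 (arXiv:1108.1335v2 TeX L1436–1440)] -/
theorem sum_reblock {V : Type*} [AddCommMonoid V] (E : Finset (TPt d (L * N')) → V) :
    ∑ Y ∈ doms d N', reblock L N' E Y = ∑ X ∈ doms d (L * N'), E X := by
  unfold reblock
  exact sum_fiberwise_of_maps_to (fun X hX => bar_mem_doms hX) E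

/-! ## Part 2. *"|Y|_M = L^d |Y|_{LM}"* as a fibre count, and the (slum) re-indexing -/

/-- `natLift ∘ proj` is the identity on index vectors with coordinates in `[0, N)`. [folklore] -/
theorem natLift_proj_of_mem_box {N : ℕ} [NeZero N] {y : Pt d} (h0 : ∀ i, 0 ≤ y i) (h1 : ∀ i, y i < N) :
    natLift (proj N y) = y := by
  funext i
  simp only [natLift, proj]
  rw [ZMod.val_intCast, Int.emod_eq_of_lt (h0 i) (h1 i)]

/-- THE FIBRES OF THE BLOCK MAP: an `LM`-block contains at most (in fact exactly) `L^d` `M`-cubes —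
`#{□ : □̄ = b} ≤ L^d` (from pv11's `coarse_eq_iff`: the block of index `b` consists of the cubes `x` with
`L b_i ≤ x_i < L(b_i + 1)`). [folklore] -/
theorem card_filter_tcoarse_eq_le (b : TPt d N') :
    (univ.filter fun a : TPt d (L * N') => tcoarse L N' a = b).card ≤ L ^ d := by
  classical
  have hL : 0 < L := Nat.pos_of_ne_zero (NeZero.ne L)
  have hLz : (0 : ℤ) < L := by exact_mod_cast hL
  set B : Finset (Pt d) :=
    Fintype.piFinset fun i => Finset.Ico ((L : ℤ) * natLift b i) ((L : ℤ) * natLift b i + L) with hB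
  have hBcard : B.card = L ^ d := by
    rw [hB, Fintype.card_piFinset]
    simp only [Int.card_Ico, add_sub_cancel_left, Int.toNat_natCast, prod_const, card_univ, Fintype.card_fin]
  have hsub : (univ.filter fun a : TPt d (L * N') => tcoarse L N' a = b) ⊆ B.image (proj (L * N')) := by
    intro a ha
    rw [mem_filter] at ha
    rw [mem_image]
    refine ⟨natLift a, ?_, proj_natLift a⟩
    -- the block of natLift a is natLift b
    have hx0 : ∀ i, 0 ≤ natLift a i := fun i => by
      show (0 : ℤ) ≤ ((a i).val : ℤ)
      exact Int.natCast_nonneg _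
    have hxN : ∀ i, natLift a i < (L : ℤ) * N' := fun i => by
      have := ZMod.val_lt (a i)
      simp only [natLift]
      exact_mod_cast this
    have hc0 : ∀ i, 0 ≤ coarse L (natLift a) i := fun i => Int.ediv_nonneg (hx0 i) hLz.le
    have hcN : ∀ i, coarse L (natLift a) i < N' := fun i => by
      show natLift a i / (L : ℤ) < N'
      rw [Int.ediv_lt_iff_lt_mul hLz]
      linarith [hxN i, mul_comm (L : ℤ) (N' : ℤ)]
    have hcb : coarse L (natLift a) = natLift b := by
      have h1 : proj N' (coarse L (natLift a)) = b := ha.2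
      rw [← natLift_proj_of_mem_box hc0 hcN, h1]
    have hbox := (coarse_eq_iff hL (natLift a) (natLift b)).1 hcb
    rw [hB, Fintype.mem_piFinset]
    intro i
    rw [Finset.mem_Ico]
    refine ⟨(hbox i).1, ?_⟩
    linarith [(hbox i).2]
  calc (univ.filter fun a : TPt d (L * N') => tcoarse L N' a = b).card
      ≤ (B.image (proj (L * N'))).card := card_le_card hsub
    _ ≤ B.card := card_image_le
    _ = L ^ d := hBcard

/-- *"|Y|_M ≤ … L³ |Y|_{LM}"* (the count inside (slum)): the number of `M`-cubes whose block lies in `Y` is at most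
`L^d |Y|`. [cite: Dimock2013, §3 Lemma 10 proof, eq. (slum) (arXiv:1108.1335v2 TeX L1462–1470)] -/
theorem card_filter_tcoarse_mem_le (Y : Finset (TPt d N')) :
    (univ.filter fun a : TPt d (L * N') => tcoarse L N' a ∈ Y).card ≤ L ^ d * Y.card := by
  classical
  have heq : (univ.filter fun a : TPt d (L * N') => tcoarse L N' a ∈ Y)
      = Y.biUnion (fun b => univ.filter fun a : TPt d (L * N') => tcoarse L N' a = b) := by
    ext a
    simp [mem_biUnion]
  rw [heq]
  calc (Y.biUnion (fun b => univ.filter fun a : TPt d (L * N') => tcoarse L N' a = b)).card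
      ≤ ∑ b ∈ Y, (univ.filter fun a : TPt d (L * N') => tcoarse L N' a = b).card := card_biUnion_le
    _ ≤ ∑ b ∈ Y, L ^ d := sum_le_sum fun b _ => card_filter_tcoarse_eq_le b
    _ = L ^ d * Y.card := by rw [sum_const, smul_eq_mul, mul_comm]

/-- THE (slum) RE-INDEXING — verbatim: *"If X̄ = Y there must be an M-cube □ so □ ⊂ X ⊂ Y. Using this …
Σ_{X: X̄ = Y} (…) ≤ Σ_{□ ⊂ Y} Σ_{X ⊃ □} (…)"*: a sum of non-negative terms over the polymers with `X̄ = Y` is at most the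
sum, over the `M`-cubes `□` whose block lies in `Y`, of the sums over all polymers through `□`.
[cite: Dimock2013, §3 Lemma 10 proof, eq. (slum) (arXiv:1108.1335v2 TeX L1462–1470)] -/
theorem sum_filter_bar_le (Y : Finset (TPt d N')) (f : Finset (TPt d (L * N')) → ℝ) (hf : ∀ X, 0 ≤ f X) :
    ∑ X ∈ (doms d (L * N')).filter (fun X => bar L N' X = Y), f X
      ≤ ∑ c ∈ univ.filter (fun a : TPt d (L * N') => tcoarse L N' a ∈ Y), ∑ X ∈ domsAt d (L * N') c, f X := by
  classical
  set S := (doms d (L * N')).filter (fun X => bar L N' X = Y) with hS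
  set F := univ.filter (fun a : TPt d (L * N') => tcoarse L N' a ∈ Y) with hF
  -- step a: every X ∈ S contains a cube of F, so f X ≤ Σ_{c ∈ F ∩ X} f X
  have ha : ∑ X ∈ S, f X ≤ ∑ X ∈ S, ∑ c ∈ F.filter (fun c => c ∈ X), f X := by
    refine sum_le_sum fun X hX => ?_
    rw [hS, mem_filter, mem_doms] at hX
    obtain ⟨⟨⟨c, hc⟩, -⟩, hbar⟩ := hX
    have hcF : c ∈ F.filter (fun c => c ∈ X) := by
      rw [mem_filter, hF, mem_filter]
      refine ⟨⟨mem_univ _, ?_⟩, hc⟩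
      rw [← hbar]
      exact mem_image_of_mem _ hc
    have hpos : 1 ≤ (F.filter (fun c => c ∈ X)).card := card_pos.2 ⟨c, hcF⟩
    rw [sum_const, nsmul_eq_mul]
    calc f X = 1 * f X := (one_mul _).symm
      _ ≤ ((F.filter (fun c => c ∈ X)).card : ℝ) * f X :=
          mul_le_mul_of_nonneg_right (by exact_mod_cast hpos) (hf X)
  -- step b: exchange the sums
  have hb : ∑ X ∈ S, ∑ c ∈ F.filter (fun c => c ∈ X), f X = ∑ c ∈ F, ∑ X ∈ S.filter (fun X => c ∈ X), f X := by
    refine sum_comm' ?_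
    intro X c
    simp only [mem_filter]
    tauto
  -- step c: S ∩ {X ∋ c} ⊆ domsAt c
  have hc : ∀ c ∈ F, ∑ X ∈ S.filter (fun X => c ∈ X), f X ≤ ∑ X ∈ domsAt d (L * N') c, f X := by
    intro c _
    refine sum_le_sum_of_subset_of_nonneg ?_ fun X _ _ => hf X
    intro X hX
    rw [mem_filter, hS, mem_filter, mem_doms] at hX
    exact mem_domsAt.2 ⟨hX.2, hX.1.1.2⟩
  calc ∑ X ∈ S, f X ≤ ∑ X ∈ S, ∑ c ∈ F.filter (fun c => c ∈ X), f X := ha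
    _ = ∑ c ∈ F, ∑ X ∈ S.filter (fun X => c ∈ X), f X := hb
    _ ≤ ∑ c ∈ F, ∑ X ∈ domsAt d (L * N') c, f X := sum_le_sum hc

/-- (summing0) IN THE MODEL, cube by cube (unit pv22's `sum_exp_torusTreeLen_le`, re-indexed over `domsAt`): for
`κ ≥ κ₀(4·2^d, 2d)`, `Σ_{X ∋ □} e^{−κ d(X)} ≤ K₀(4·2^d, 2d)`. [cite: Dimock2013, §3.1 eq. (summing0) and App. A Lemma 25 (basic2) (arXiv:1108.1335v2 TeX L1350–1355, L3080–3136)] -/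
theorem sum_domsAt_exp_le {n : ℕ} [NeZero n] (c : TPt d n) {κ : ℝ} (hκ : kappa₀ (4 * 2 ^ d) (2 * d) ≤ κ) :
    ∑ X ∈ domsAt d n c, exp (-κ * torusTreeLen X) ≤ K₀ (4 * 2 ^ d) (2 * d) := by
  classical
  have h := sum_exp_torusTreeLen_le d n c hκ
  have heq : domsAt d n c = univ.filter (fun X : Finset (TPt d n) => c ∈ X ∧ TFaceConnected X) := by
    ext X
    rw [mem_domsAt, mem_filter]
    simp
  rw [heq]
  convert h using 2

/-! ## Part 3. LEMMA 10 (reblocking), PROVED -/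

/-- **[Dimock2013] LEMMA 10 (reblocking) ON THE CELL'S MODEL, every dimension** — norm-bound in ⟹ norm-bound out:
if `‖E(X)‖ ≤ A e^{−κ d(X)}` for every `X ∈ 𝒟_k` (i.e. `A ≥ ‖E‖_{k,κ}`), `κ ≥ κ₀ = κ₀(4·2^d, 2d)`, then for every
`Y ∈ 𝒟⁰_{k+1}`:  `‖(ℬE)(Y)‖ ≤ 2^d K₀ L^d A e^{−(L(κ−κ₀) − 4) d(Y)}`.  The printed chain (study0) → (slum) → (study00) step
by step: triangle inequality; `d(X) ≥ L d(Y)` for `X̄ = Y` (pv22 `mul_torusTreeLen_image_le`); re-indexing over the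
`≤ L^d|Y|` cubes whose block lies in `Y` (`sum_filter_bar_le`, `card_filter_tcoarse_mem_le`) and (summing0)
(`sum_domsAt_exp_le`); the volume bound `|Y| ≤ 2^d(4d(Y)+1) ≤ 2^d e^{4 d(Y)}` (pv22 `card_le_torusTreeLen`) — whence the
rate offset `4` (printed: `1`, from «|Y|_{LM} ≤ 9(1 + d_{LM}(Y))») and the prefactor `2^d K₀ L^d` (printed, d = 3:
`9K₀L³`), DECLARED divergence of constants. [cite: Dimock2013, §3 Lemma 10 (reblocking) (arXiv:1108.1335v2 TeX L1443–1478)] -/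
theorem norm_reblock_le {V : Type*} [SeminormedAddCommGroup V] (E : Finset (TPt d (L * N')) → V) {A κ : ℝ}
    (hA : 0 ≤ A) (hκ : kappa₀ (4 * 2 ^ d) (2 * d) ≤ κ)
    (hE : ∀ X ∈ doms d (L * N'), ‖E X‖ ≤ A * exp (-κ * torusTreeLen X))
    {Y : Finset (TPt d N')} (hY : Y ∈ doms d N') :
    ‖reblock L N' E Y‖ ≤ 2 ^ d * K₀ (4 * 2 ^ d) (2 * d) * L ^ d * A *
        exp (-(L * (κ - kappa₀ (4 * 2 ^ d) (2 * d)) - 4) * torusTreeLen Y) := by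
  classical
  set κ₀ := kappa₀ (4 * 2 ^ d) (2 * d) with hκ₀
  set K := K₀ (4 * 2 ^ d) (2 * d) with hK
  have hKpos : 0 < K := K₀_pos _ _
  have hL : 0 < L := Nat.pos_of_ne_zero (NeZero.ne L)
  have hLr : (0 : ℝ) < L := by exact_mod_cast hL
  set S := (doms d (L * N')).filter (fun X => bar L N' X = Y) with hS
  set F := univ.filter (fun a : TPt d (L * N') => tcoarse L N' a ∈ Y) with hF
  set dY := torusTreeLen Y with hdY
  have hdY0 : 0 ≤ dY := torusTreeLen_nonneg Y
  -- (study0), first two inequalities, with the coarsening d(X) ≥ L d(Y) inserted termwise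
  have h1 : ‖reblock L N' E Y‖ ≤ ∑ X ∈ S, ‖E X‖ := norm_sum_le _ _
  have h2 : ∀ X ∈ S, ‖E X‖ ≤ A * exp (-(κ - κ₀) * L * dY) * exp (-κ₀ * torusTreeLen X) := by
    intro X hX
    rw [hS, mem_filter] at hX
    have hXd : X ∈ doms d (L * N') := hX.1
    have hXd' := mem_doms.1 hXd
    have hcoarse : (L : ℝ) * dY ≤ torusTreeLen X := by
      have := mul_torusTreeLen_image_le (L := L) (N' := N') hXd'.1 hXd'.2
      rw [hdY, ← hX.2]
      exact this
    have hsplit : exp (-κ * torusTreeLen X)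
        = exp (-(κ - κ₀) * torusTreeLen X) * exp (-κ₀ * torusTreeLen X) := by
      rw [← Real.exp_add]; ring_nf
    have hmono : exp (-(κ - κ₀) * torusTreeLen X) ≤ exp (-(κ - κ₀) * L * dY) := by
      rw [Real.exp_le_exp]
      have hk : 0 ≤ κ - κ₀ := by rw [hκ₀]; linarith
      nlinarith
    calc ‖E X‖ ≤ A * exp (-κ * torusTreeLen X) := hE X hXd
      _ = A * (exp (-(κ - κ₀) * torusTreeLen X) * exp (-κ₀ * torusTreeLen X)) := by rw [hsplit]
      _ ≤ A * (exp (-(κ - κ₀) * L * dY) * exp (-κ₀ * torusTreeLen X)) := by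
          refine mul_le_mul_of_nonneg_left ?_ hA
          exact mul_le_mul_of_nonneg_right hmono (Real.exp_pos _).le
      _ = A * exp (-(κ - κ₀) * L * dY) * exp (-κ₀ * torusTreeLen X) := by ring
  -- (slum): Σ_{X̄ = Y} e^{−κ₀ d(X)} ≤ L^d |Y| K₀
  have h3 : ∑ X ∈ S, exp (-κ₀ * torusTreeLen X) ≤ (L : ℝ) ^ d * Y.card * K := by
    have hstep := sum_filter_bar_le (L := L) (N' := N') Y (fun X => exp (-κ₀ * torusTreeLen X))
      (fun X => (Real.exp_pos _).le)
    have hF' : ∑ c ∈ F, ∑ X ∈ domsAt d (L * N') c, exp (-κ₀ * torusTreeLen X) ≤ ∑ c ∈ F, K :=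
      sum_le_sum fun c _ => sum_domsAt_exp_le c (le_of_eq hκ₀.symm)
    have hcard : (F.card : ℝ) ≤ (L : ℝ) ^ d * Y.card := by
      have := card_filter_tcoarse_mem_le (L := L) (N' := N') Y
      rw [hF]
      exact_mod_cast this
    calc ∑ X ∈ S, exp (-κ₀ * torusTreeLen X)
        ≤ ∑ c ∈ F, ∑ X ∈ domsAt d (L * N') c, exp (-κ₀ * torusTreeLen X) := hstep
      _ ≤ ∑ c ∈ F, K := hF'
      _ = (F.card : ℝ) * K := by rw [sum_const, nsmul_eq_mul]
      _ ≤ (L : ℝ) ^ d * Y.card * K := mul_le_mul_of_nonneg_right hcard hKpos.le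
  -- (study00): |Y| ≤ 2^d (4 d(Y) + 1) ≤ 2^d e^{4 d(Y)}
  have h4 : (Y.card : ℝ) ≤ 2 ^ d * exp (4 * dY) := by
    have hYd := mem_doms.1 hY
    have hv := card_le_torusTreeLen hYd.1 hYd.2
    have he : 4 * dY + 1 ≤ exp (4 * dY) := Real.add_one_le_exp _
    have h2d : (0 : ℝ) ≤ 2 ^ d := by positivity
    calc (Y.card : ℝ) ≤ 2 ^ d * (4 * dY + 1) := hv
      _ ≤ 2 ^ d * exp (4 * dY) := mul_le_mul_of_nonneg_left he h2d
  -- assemble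
  have hB : 0 ≤ A * exp (-(κ - κ₀) * L * dY) := mul_nonneg hA (Real.exp_pos _).le
  calc ‖reblock L N' E Y‖ ≤ ∑ X ∈ S, ‖E X‖ := h1
    _ ≤ ∑ X ∈ S, A * exp (-(κ - κ₀) * L * dY) * exp (-κ₀ * torusTreeLen X) := sum_le_sum h2
    _ = A * exp (-(κ - κ₀) * L * dY) * ∑ X ∈ S, exp (-κ₀ * torusTreeLen X) := by rw [mul_sum]
    _ ≤ A * exp (-(κ - κ₀) * L * dY) * ((L : ℝ) ^ d * Y.card * K) := mul_le_mul_of_nonneg_left h3 hB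
    _ ≤ A * exp (-(κ - κ₀) * L * dY) * ((L : ℝ) ^ d * (2 ^ d * exp (4 * dY)) * K) := by
        refine mul_le_mul_of_nonneg_left ?_ hB
        refine mul_le_mul_of_nonneg_right ?_ hKpos.le
        exact mul_le_mul_of_nonneg_left h4 (by positivity)
    _ = 2 ^ d * K * L ^ d * A * (exp (-(κ - κ₀) * L * dY) * exp (4 * dY)) := by ring
    _ = 2 ^ d * K * L ^ d * A * exp (-(L * (κ - κ₀) - 4) * dY) := by
        rw [← Real.exp_add]; ring_nf

/-- **LEMMA 10 IN THE PRINTED SHAPE** — *"For κ′ = L(κ − κ₀ − 1): ‖ℬE‖_{k,κ′} ≤ [9K₀L³] ‖E‖_{k,κ}"*: for every `L ≥ 4`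
(so that `L(κ − κ₀ − 1) ≤ L(κ − κ₀) − 4`) the bound of `norm_reblock_le` gives
`‖(ℬE)(Y)‖ ≤ 2^d K₀ L^d A e^{−L(κ−κ₀−1) d(Y)}`. [cite: Dimock2013, §3 Lemma 10 (reblocking) (arXiv:1108.1335v2 TeX L1443–1447)] -/
theorem norm_reblock_le_printed {V : Type*} [SeminormedAddCommGroup V] (E : Finset (TPt d (L * N')) → V) {A κ : ℝ}
    (hA : 0 ≤ A) (hκ : kappa₀ (4 * 2 ^ d) (2 * d) ≤ κ) (hL4 : 4 ≤ L)
    (hE : ∀ X ∈ doms d (L * N'), ‖E X‖ ≤ A * exp (-κ * torusTreeLen X))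
    {Y : Finset (TPt d N')} (hY : Y ∈ doms d N') :
    ‖reblock L N' E Y‖ ≤ 2 ^ d * K₀ (4 * 2 ^ d) (2 * d) * L ^ d * A *
        exp (-(L * (κ - kappa₀ (4 * 2 ^ d) (2 * d) - 1)) * torusTreeLen Y) := by
  have h := norm_reblock_le (L := L) (N' := N') E hA hκ hE hY
  refine h.trans (mul_le_mul_of_nonneg_left ?_ ?_)
  · rw [Real.exp_le_exp]
    have hL4r : (4 : ℝ) ≤ L := by exact_mod_cast hL4
    have hdY0 : 0 ≤ torusTreeLen Y := torusTreeLen_nonneg Y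
    nlinarith
  · have := K₀_pos (4 * 2 ^ d) (2 * d)
    positivity

/-! ### The printed sup-norm formulation -/

/-- THE DECAY NORM — [Dimock2013] §3.1, verbatim: *"‖E‖_{k,κ} = sup_X ‖E(X)‖_k e^{κ d_M(X)}"* (sup over `X ∈ 𝒟_k`;
a finite supremum on the torus, `𝒟_k ≠ ∅`). [cite: Dimock2013, §3.1 (arXiv:1108.1335v2 TeX L1333)] -/
def decayNorm {V : Type*} [SeminormedAddCommGroup V] (n : ℕ) [NeZero n] (κ : ℝ) (E : Finset (TPt d n) → V) : ℝ :=
  (doms d n).sup' (doms_nonempty d n) fun X => ‖E X‖ * exp (κ * torusTreeLen X)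

/-- `‖E‖_{k,κ} ≥ 0`. [folklore] -/
theorem decayNorm_nonneg {V : Type*} [SeminormedAddCommGroup V] {n : ℕ} [NeZero n] (κ : ℝ)
    (E : Finset (TPt d n) → V) : 0 ≤ decayNorm n κ E := by
  unfold decayNorm
  obtain ⟨X, hX⟩ := doms_nonempty d n
  exact le_sup'_of_le _ hX (mul_nonneg (norm_nonneg _) (Real.exp_pos _).le)

/-- The pointwise form of the decay norm: `‖E(X)‖ ≤ ‖E‖_{k,κ} e^{−κ d(X)}` for `X ∈ 𝒟_k`. [folklore] -/
theorem norm_le_decayNorm_mul_exp {V : Type*} [SeminormedAddCommGroup V] {n : ℕ} [NeZero n] (κ : ℝ)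
    (E : Finset (TPt d n) → V) {X : Finset (TPt d n)} (hX : X ∈ doms d n) :
    ‖E X‖ ≤ decayNorm n κ E * exp (-κ * torusTreeLen X) := by
  have h : ‖E X‖ * exp (κ * torusTreeLen X) ≤ decayNorm n κ E := by
    unfold decayNorm
    exact le_sup' (fun X => ‖E X‖ * exp (κ * torusTreeLen X)) hX
  have hpos : 0 < exp (κ * torusTreeLen X) := Real.exp_pos _
  have hinv : exp (-κ * torusTreeLen X) = (exp (κ * torusTreeLen X))⁻¹ := by
    rw [← Real.exp_neg]; ring_nf
  rw [hinv, ← div_eq_mul_inv, le_div_iff₀ hpos]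
  exact h

/-- **LEMMA 10 AS PRINTED, a norm inequality**: for `κ ≥ κ₀(4·2^d, 2d)`, `L ≥ 4` and `κ′ = L(κ − κ₀ − 1)`,
`‖ℬE‖_{κ′} ≤ 2^d K₀(4·2^d, 2d) L^d ‖E‖_κ` (the left norm taken with the coarse tree length, *"defined with d_{LM}"*).
[cite: Dimock2013, §3 Lemma 10 (reblocking) (arXiv:1108.1335v2 TeX L1443–1447)] -/
theorem decayNorm_reblock_le {V : Type*} [SeminormedAddCommGroup V] (E : Finset (TPt d (L * N')) → V) {κ : ℝ}
    (hκ : kappa₀ (4 * 2 ^ d) (2 * d) ≤ κ) (hL4 : 4 ≤ L) :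
    decayNorm N' (L * (κ - kappa₀ (4 * 2 ^ d) (2 * d) - 1)) (reblock L N' E)
      ≤ 2 ^ d * K₀ (4 * 2 ^ d) (2 * d) * L ^ d * decayNorm (L * N') κ E := by
  unfold decayNorm
  refine sup'_le _ _ fun Y hY => ?_
  have hb := norm_reblock_le_printed (L := L) (N' := N') E (decayNorm_nonneg κ E) hκ hL4
    (fun X hX => norm_le_decayNorm_mul_exp κ E hX) hY
  have hpos : 0 < exp (L * (κ - kappa₀ (4 * 2 ^ d) (2 * d) - 1) * torusTreeLen Y) := Real.exp_pos _
  have hcancel : exp (-(L * (κ - kappa₀ (4 * 2 ^ d) (2 * d) - 1)) * torusTreeLen Y)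
      * exp (L * (κ - kappa₀ (4 * 2 ^ d) (2 * d) - 1) * torusTreeLen Y) = 1 := by
    rw [← Real.exp_add]; ring_nf; exact Real.exp_zero
  calc ‖reblock L N' E Y‖ * exp (L * (κ - kappa₀ (4 * 2 ^ d) (2 * d) - 1) * torusTreeLen Y)
      ≤ (2 ^ d * K₀ (4 * 2 ^ d) (2 * d) * L ^ d * decayNorm (L * N') κ E *
          exp (-(L * (κ - kappa₀ (4 * 2 ^ d) (2 * d) - 1)) * torusTreeLen Y))
          * exp (L * (κ - kappa₀ (4 * 2 ^ d) (2 * d) - 1) * torusTreeLen Y) :=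
        mul_le_mul_of_nonneg_right hb hpos.le
    _ = 2 ^ d * K₀ (4 * 2 ^ d) (2 * d) * L ^ d * decayNorm (L * N') κ E := by
        rw [mul_assoc, hcancel, mul_one]

/-- **`d = 3` (the printed dimension)**: `‖ℬE‖_{κ′} ≤ 8 K₀(32, 6) L³ ‖E‖_κ` for `κ′ = L(κ − κ₀(32,6) − 1)`, `L ≥ 4`,
`κ ≥ κ₀(32, 6)` — printed: *"9 K₀ L³"* with Dimock's own `κ₀, K₀` and his (ninety)-constant «9»; here the cell's
`κ₀(32,6), K₀(32,6)` of `…B12TreeDecay` (as in `…Dimock2011to13.Phi43PolymerRepresentation`) and `2³ = 8` from the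
cell's volume bound. [cite: Dimock2013, §3 Lemma 10 (reblocking) (arXiv:1108.1335v2 TeX L1443–1447)] -/
theorem decayNorm_reblock_le_three {V : Type*} [SeminormedAddCommGroup V] (E : Finset (TPt 3 (L * N')) → V) {κ : ℝ}
    (hκ : kappa₀ 32 6 ≤ κ) (hL4 : 4 ≤ L) :
    decayNorm N' (L * (κ - kappa₀ 32 6 - 1)) (reblock L N' E) ≤ 8 * K₀ 32 6 * L ^ 3 * decayNorm (L * N') κ E := by
  have e1 : ((4 : ℝ) * 2 ^ 3) = 32 := by norm_num
  have e2 : (2 * 3 : ℕ) = 6 := by norm_num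
  have h := decayNorm_reblock_le (d := 3) (L := L) (N' := N') E (κ := κ) (by rw [e1, e2]; exact hκ) hL4
  rw [e1, e2] at h
  have e3 : ((2 : ℝ) ^ 3) = 8 := by norm_num
  rw [e3] at h
  exact h

/-! ## Part 4 (v1.1, append-only after the v1 declarations). (shotgun): the reblocking map at the SAME decay rate -/

/-- The decay norm is monotone in the rate: `κ ≤ κ′ ⟹ ‖F‖_κ ≤ ‖F‖_{κ′}` (tree lengths are `≥ 0`). [folklore] -/
theorem decayNorm_mono {V : Type*} [SeminormedAddCommGroup V] {n : ℕ} [NeZero n] {κ κ' : ℝ} (h : κ ≤ κ')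
    (F : Finset (TPt d n) → V) : decayNorm n κ F ≤ decayNorm n κ' F := by
  unfold decayNorm
  refine sup'_le _ _ fun X hX => ?_
  refine le_sup'_of_le _ hX ?_
  refine mul_le_mul_of_nonneg_left ?_ (norm_nonneg _)
  rw [Real.exp_le_exp]
  exact mul_le_mul_of_nonneg_right h (torusTreeLen_nonneg X)

/-- **(shotgun), the form USED downstream** — [Dimock2013] §3, right after Lemma 10, verbatim: *"If we combine them we
have a map E → (ℬE)_{L^{−1}} from 𝒦_k to 𝒦_{k+1}. Since d_{LM}(LX) = d_M(X) we have: ‖(ℬE)_{L^{−1}}‖_{k+1,κ′} = …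
= ‖ℬE‖_{k,κ′} ≤ 9K₀L³‖E‖_{k,κ}"* (shotgun0) and *"Assuming κ ≤ κ′ (a condition that κ be large) we have
‖(ℬE)_{L^{−1}}‖_{k+1,κ} ≤ 9K₀L³‖E‖_{k,κ}"* (shotgun).  On the model the scaled-down functional `(ℬE)_{L^{−1}}` IS
`reblock L N′ E` read on the coarse torus (its `LM`-cubes are the `M`-cubes of scale `k+1`), so (shotgun0) is
`decayNorm_reblock_le` and (shotgun) follows by monotonicity of the norm in the rate: for `κ ≥ κ₀(4·2^d, 2d)`, `L ≥ 4`
and `κ ≤ L(κ − κ₀ − 1)`, `‖ℬE‖_κ ≤ 2^d K₀ L^d ‖E‖_κ` — the one-step map is bounded at the SAME rate `κ`.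
[cite: Dimock2013, §3 eqs. (shotgun0), (shotgun) (arXiv:1108.1335v2 TeX L1481–1495)] -/
theorem decayNorm_reblock_le_same_rate {V : Type*} [SeminormedAddCommGroup V] (E : Finset (TPt d (L * N')) → V)
    {κ : ℝ} (hκ : kappa₀ (4 * 2 ^ d) (2 * d) ≤ κ) (hL4 : 4 ≤ L)
    (hκκ' : κ ≤ L * (κ - kappa₀ (4 * 2 ^ d) (2 * d) - 1)) :
    decayNorm N' κ (reblock L N' E) ≤ 2 ^ d * K₀ (4 * 2 ^ d) (2 * d) * L ^ d * decayNorm (L * N') κ E :=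
  (decayNorm_mono hκκ' _).trans (decayNorm_reblock_le (L := L) (N' := N') E hκ hL4)

/-- (shotgun) at `d = 3`: `κ ≥ κ₀(32,6)`, `L ≥ 4`, `κ ≤ L(κ − κ₀(32,6) − 1)` ⟹ `‖ℬE‖_κ ≤ 8 K₀(32,6) L³ ‖E‖_κ` (printed:
`9K₀L³`). [cite: Dimock2013, §3 eq. (shotgun) (arXiv:1108.1335v2 TeX L1492–1495)] -/
theorem decayNorm_reblock_le_same_rate_three {V : Type*} [SeminormedAddCommGroup V]
    (E : Finset (TPt 3 (L * N')) → V) {κ : ℝ} (hκ : kappa₀ 32 6 ≤ κ) (hL4 : 4 ≤ L)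
    (hκκ' : κ ≤ L * (κ - kappa₀ 32 6 - 1)) :
    decayNorm N' κ (reblock L N' E) ≤ 8 * K₀ 32 6 * L ^ 3 * decayNorm (L * N') κ E :=
  (decayNorm_mono hκκ' _).trans (decayNorm_reblock_le_three (L := L) (N' := N') E hκ hL4)

end TwoScales

end Literature.MathematicalPhysics.QuantumFieldTheory.Dimock2011to13.Reblocking

end
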